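import Summits.BirchSwinnertonDyer.BirchSwinnertonDyer.Theorems.KolyvaginRoadThreeZhangInductionOfKolyvaginSystem
import HarnessLib

/-!
# Route `KolyvaginRoadThree`, deciding crux `ZhangSharpFrameAtThreeHL` (item stmt-BirchSwinnertonDyer-19574):
# Zhang's Lemma 8.4 and the METHOD engine with the Čebotarev input (Cheb) asked for EIGENCLASSES ONLY — the
# shape of the tree's kernel theorem `McCallum1991_cor_3_2_pow_of_chebotarev`
# (cell `bsd-stepL`, ACCEL seat `bsd-stepL-koly3b` g3; `--supports stmt-BirchSwinnertonDyer-19574`, helper; sharpening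
# of `KolyvaginRoadThreeZhangTriangulation{Config,}.lean` ∕ `…ZhangInductionOfKolyvaginSystem.lean`)

HONEST FRAMING. Pure linear algebra over an arbitrary field `F`; nothing about elliptic curves, Heegner points,
level raising or `p = 3` is asserted; every number-theoretic input is an explicitly named HYPOTHESIS SHAPE
(module docstring of `KolyvaginRoadThreeZhangTriangulationBasis.lean`); 0 definitions, 0 named facts, 0 `sorry`.
PARTITION: O2@3 (B10) × A1 × crux 19574 — none (composition-engine input; types nothing, closes nothing; T7).

WHY THIS FILE. The landed theorems `exists_configuration` (p481467), `triangulation_at` ∕ `triangulation`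
(p481938) and `exists_ne_zero_of_zhangInduction_on_of_kolyvaginSystem` (p483236) ask the one-class Čebotarev input
in the form `hCheb1 : ∀ x ≠ 0, ∃ ℓ ∉ S, loc_ℓ x ≠ 0` for EVERY non-zero class `x`. The proofs use it only on
Kolyvagin classes, which are EIGENCLASSES of complex conjugation (`c m ∈ E (ε₀ ^^ Nat.bodd m.card)`), and the
tree's Čebotarev theorem — x11b3's `Literature.NumberTheory.EllipticCurves.McCallum1991_cor_3_2_pow_of_chebotarev`
(McCallum 1991 Cor. 3.2, kernel modulo the named facts `Automorphic.chebotarev_artinRep` and `exists_weilPairing`) —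
is stated for `τ`-eigenclasses (`hτ : conjAct c = ±c`). This file re-issues the four statements with
`hCheb1 : ∀ s, ∀ x ∈ E s, x ≠ 0 → ∀ S, ∃ ℓ ∉ S, loc_ℓ x ≠ 0` (eigenclasses only; `r = 1` of Cor. 3.2), so that
BOTH Čebotarev inputs of the (A3)-brick ((Cheb1) with `r = 1`, (Cheb2) with `r = 2` and opposite signs) are
instances of that kernel theorem, with NO local `τ`-structure needed by an instantiation. The proofs are the landed
ones verbatim except at the two uses of (Cheb1) (the junk prime `ℓ₀` and the last prime `ℓ_{2ν+1}`, both seen by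
eigenclasses). The stronger-hypothesis originals remain (and follow from these by weakening).

References: [cite: WZhang2014, Lemma 8.1, Lemma 8.4, Thm. 9.1] [cite: McCallumLMS1991, Prop. 3.1, Cor. 3.2, Lemma 5.3].
-/

namespace Summit.BirchSwinnertonDyer.Rank1Residual.X11b.Three.Koly.ZhangTriangulation

open Module Finset

variable {F : Type*} [Field F] {H : Type*} [AddCommGroup H] [Module F H]
variable {P : Type*} {Hv : P → Type*} [∀ v, AddCommGroup (Hv v)] [∀ v, Module F (Hv v)]
variable {ι : Type*} {Q : Type*}

/-- **The primes `ℓ₁, …, ℓ_{2ν+1}` of Lemma 8.4 (2), (Cheb1) for eigenclasses only** — `exists_configuration` with the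
one-class Čebotarev input restricted to classes of a sign (the only classes it is applied to: `c(m₀)` and
`c(n_{ν+1})`). [cite: WZhang2014, Lemma 8.4 (2), proof pp. 237–238] [cite: McCallumLMS1991, Cor. 3.2 (r = 1, 2)] -/
theorem exists_configuration_eigen [DecidableEq ι] [DecidableEq P] (E : Bool → Submodule F H)
    (loc : (v : P) → H →ₗ[F] Hv v) (b : (v : P) → Hv v →ₗ[F] Hv v →ₗ[F] F) (L : (v : P) → Submodule F (Hv v))
    (pl : ι → P) (Fv Tv : (ℓ : ι) → Submodule F (Hv (pl ℓ))) (c : Finset ι → H) (ε₀ : Bool)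
    (hpl : Function.Injective pl)
    (hLF : ∀ ℓ, L (pl ℓ) = Fv ℓ)
    (hisoL : ∀ (v : P), ∀ x ∈ L v, ∀ y ∈ L v, b v x y = 0)
    (hisoT : ∀ (ℓ : ι), ∀ x ∈ Tv ℓ, ∀ y ∈ Tv ℓ, b (pl ℓ) x y = 0)
    (hperf : ∀ (ℓ : ι) (s : Bool), ∀ x ∈ E s, ∀ y ∈ E s, loc (pl ℓ) x ∈ Fv ℓ → loc (pl ℓ) x ≠ 0 →
      loc (pl ℓ) y ∈ Tv ℓ → loc (pl ℓ) y ≠ 0 → b (pl ℓ) (loc (pl ℓ) x) (loc (pl ℓ) y) ≠ 0)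
    (hrec : ∀ (x y : H) (T : Finset P), (∀ v, v ∉ T → b v (loc v x) (loc v y) = 0) →
      ∑ v ∈ T, b v (loc v x) (loc v y) = 0)
    (hcE : ∀ m : Finset ι, c m ∈ E (ε₀ ^^ Nat.bodd m.card))
    (hcL : ∀ (m : Finset ι) (v : P), (∀ ℓ ∈ m, pl ℓ ≠ v) → loc v (c m) ∈ L v)
    (hcT : ∀ (m : Finset ι), ∀ ℓ ∈ m, loc (pl ℓ) (c m) ∈ Tv ℓ)
    (hfs : ∀ (m : Finset ι) (ℓ : ι), ℓ ∉ m → (loc (pl ℓ) (c (insert ℓ m)) = 0 ↔ loc (pl ℓ) (c m) = 0))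
    (hCheb1 : ∀ (s : Bool), ∀ x ∈ E s, x ≠ 0 → ∀ S : Finset ι, ∃ ℓ, ℓ ∉ S ∧ loc (pl ℓ) x ≠ 0)
    (hCheb2 : ∀ (s : Bool), ∀ x ∈ E s, ∀ y ∈ E (!s), x ≠ 0 → y ≠ 0 → ∀ S : Finset ι,
      ∃ ℓ, ℓ ∉ S ∧ loc (pl ℓ) x ≠ 0 ∧ loc (pl ℓ) y ≠ 0)
    (hSupply : ∀ (ℓ : ι) (S : Finset ι), ℓ ∉ S → ∀ s : Bool, ∃ x ∈ E s, x ≠ 0 ∧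
      (∀ v : P, v ≠ pl ℓ → (∀ ℓ' ∈ S, pl ℓ' ≠ v) → loc v x ∈ L v) ∧ ∀ ℓ' ∈ S, loc (pl ℓ') x ∈ Tv ℓ')
    {ν : ℕ} (hν : ∃ m : Finset ι, m.card = ν ∧ c m ≠ 0) :
    ∃ f : ℕ → ι, Set.InjOn f (Set.Iio (2 * ν + 1)) ∧
      ∀ i ≤ ν, loc (pl (f (ν + i))) (c ((Finset.Ico i (ν + i)).image f)) ≠ 0 := by
  obtain ⟨m₀, hm₀, hcm₀⟩ := hν
  obtain ⟨ℓ₀, -, -⟩ := hCheb1 _ (c m₀) (hcE m₀) hcm₀ ∅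
  -- the induction of p. 237: after j slides
  have key : ∀ j ≤ ν, ∃ f : ℕ → ι, Set.InjOn f (Set.Iio (ν + j)) ∧
      c ((Finset.Ico j (ν + j)).image f) ≠ 0 ∧
      ∀ i < j, loc (pl (f (ν + i))) (c ((Finset.Ico i (ν + i)).image f)) ≠ 0 := by
    intro j
    induction j with
    | zero =>
      intro _
      obtain ⟨f, hf, hfm⟩ := exists_enum m₀ ℓ₀
      refine ⟨f, ?_, ?_, fun i hi ↦ absurd hi (Nat.not_lt_zero i)⟩
      · rw [Nat.add_zero, ← hm₀]
        exact hf
      · rw [Nat.add_zero, ← hm₀, hfm]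
        exact hcm₀
    | succ j ih =>
      intro hj
      obtain ⟨f, hf, hcW, hdiag⟩ := ih (Nat.le_of_succ_le hj)
      have hν : 0 < ν := by omega
      have hcard : ((Finset.Ico j (ν + j)).image f).card = ν := card_window hf le_rfl
      have hmem : f j ∈ (Finset.Ico j (ν + j)).image f :=
        Finset.mem_image.mpr ⟨j, Finset.mem_Ico.mpr ⟨le_rfl, by omega⟩, rfl⟩
      obtain ⟨ℓ', hℓ'S, -, hℓ'c, hc'⟩ := slide E loc b L pl Fv Tv c ε₀ hpl hLF hisoL hisoT hperf hrec hcE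
        hcL hcT hfs hCheb2 hSupply hcard hcW hmem ((Finset.range (ν + j)).image f)
      refine ⟨Function.update f (ν + j) ℓ', injOn_update hf hℓ'S, ?_, ?_⟩
      · rw [window_update ℓ' hν, ← window_erase hf le_rfl hν]
        exact hc'
      · intro i hi
        rcases Nat.lt_succ_iff_lt_or_eq.mp hi with hi | rfl
        · rw [Function.update_of_ne (by omega : ν + i ≠ ν + j),
            window_congr (g := f) (fun t _ ht ↦ Function.update_of_ne (by omega) _ _)]
          exact hdiag i hi
        · rw [Function.update_self, window_congr (g := f) (fun t _ ht ↦ Function.update_of_ne (by omega) _ _)]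
          exact hℓ'c
  -- the last prime ℓ_{2ν+1} (p. 238): seen by c(n_{ν+1})
  obtain ⟨f, hf, hcW, hdiag⟩ := key ν le_rfl
  have hWE : c ((Finset.Ico ν (ν + ν)).image f) ∈ E (ε₀ ^^ Nat.bodd ν) := by
    have h := hcE ((Finset.Ico ν (ν + ν)).image f)
    rwa [card_window hf le_rfl] at h
  obtain ⟨ℓ'', hℓ''S, hℓ''c⟩ := hCheb1 _ _ hWE hcW ((Finset.range (ν + ν)).image f)
  refine ⟨Function.update f (ν + ν) ℓ'', ?_, ?_⟩
  · have h := injOn_update hf hℓ''S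
    rwa [show 2 * ν + 1 = ν + ν + 1 by omega]
  · intro i hi
    rcases Nat.lt_or_eq_of_le hi with hi | rfl
    · rw [Function.update_of_ne (by omega : ν + i ≠ ν + ν),
        window_congr (g := f) (fun t _ ht ↦ Function.update_of_ne (by omega) _ _)]
      exact hdiag i hi
    · rw [Function.update_self, window_congr (g := f) (fun t _ ht ↦ Function.update_of_ne (by omega) _ _)]
      exact hℓ''c

/-- **Zhang's Lemma 8.4 (1)+(3) at the vanishing order `ν`, (Cheb1) for eigenclasses only** — `triangulation_at`
with the weaker one-class Čebotarev input. [cite: WZhang2014, Lemma 8.4 (1)–(3), pp. 236–239]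
[cite: McCallumLMS1991, Cor. 3.2, Lemma 5.3] -/
theorem triangulation_at_eigen [DecidableEq ι] [DecidableEq P] (E : Bool → Submodule F H)
    (loc : (v : P) → H →ₗ[F] Hv v) (b : (v : P) → Hv v →ₗ[F] Hv v →ₗ[F] F) (L : (v : P) → Submodule F (Hv v))
    (pl : ι → P) (Fv Tv : (ℓ : ι) → Submodule F (Hv (pl ℓ))) (c : Finset ι → H) (ε₀ : Bool)
    (B : Set P) (Sel SelRel : Bool → Submodule F H)
    (hSel : ∀ (s : Bool) (x : H), x ∈ Sel s ↔ x ∈ E s ∧ ∀ v, loc v x ∈ L v)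
    (hSelRel : ∀ (s : Bool) (x : H), x ∈ SelRel s ↔ x ∈ E s ∧ ∀ v, v ∉ B → loc v x ∈ L v)
    (hfin : ∀ s, FiniteDimensional F (SelRel s))
    (hB : ∀ v ∈ B, ∀ m : Finset ι, loc v (c m) = 0)
    (hpl : Function.Injective pl)
    (hLF : ∀ ℓ, L (pl ℓ) = Fv ℓ)
    (hisoL : ∀ (v : P), ∀ x ∈ L v, ∀ y ∈ L v, b v x y = 0)
    (hisoT : ∀ (ℓ : ι), ∀ x ∈ Tv ℓ, ∀ y ∈ Tv ℓ, b (pl ℓ) x y = 0)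
    (hperf : ∀ (ℓ : ι) (s : Bool), ∀ x ∈ E s, ∀ y ∈ E s, loc (pl ℓ) x ∈ Fv ℓ → loc (pl ℓ) x ≠ 0 →
      loc (pl ℓ) y ∈ Tv ℓ → loc (pl ℓ) y ≠ 0 → b (pl ℓ) (loc (pl ℓ) x) (loc (pl ℓ) y) ≠ 0)
    (hline : ∀ (ℓ : ι) (s : Bool), ∃ e : Hv (pl ℓ), ∀ x ∈ E s, loc (pl ℓ) x ∈ Fv ℓ →
      ∃ a : F, loc (pl ℓ) x = a • e)
    (hrec : ∀ (x y : H) (T : Finset P), (∀ v, v ∉ T → b v (loc v x) (loc v y) = 0) →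
      ∑ v ∈ T, b v (loc v x) (loc v y) = 0)
    (hcE : ∀ m : Finset ι, c m ∈ E (ε₀ ^^ Nat.bodd m.card))
    (hcL : ∀ (m : Finset ι) (v : P), (∀ ℓ ∈ m, pl ℓ ≠ v) → loc v (c m) ∈ L v)
    (hcT : ∀ (m : Finset ι), ∀ ℓ ∈ m, loc (pl ℓ) (c m) ∈ Tv ℓ)
    (hfs : ∀ (m : Finset ι) (ℓ : ι), ℓ ∉ m → (loc (pl ℓ) (c (insert ℓ m)) = 0 ↔ loc (pl ℓ) (c m) = 0))
    (hCheb1 : ∀ (s : Bool), ∀ x ∈ E s, x ≠ 0 → ∀ S : Finset ι, ∃ ℓ, ℓ ∉ S ∧ loc (pl ℓ) x ≠ 0)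
    (hCheb2 : ∀ (s : Bool), ∀ x ∈ E s, ∀ y ∈ E (!s), x ≠ 0 → y ≠ 0 → ∀ S : Finset ι,
      ∃ ℓ, ℓ ∉ S ∧ loc (pl ℓ) x ≠ 0 ∧ loc (pl ℓ) y ≠ 0)
    (hSupply : ∀ (ℓ : ι) (S : Finset ι), ℓ ∉ S → ∀ s : Bool, ∃ x ∈ E s, x ≠ 0 ∧
      (∀ v : P, v ≠ pl ℓ → (∀ ℓ' ∈ S, pl ℓ' ≠ v) → loc v x ∈ L v) ∧ ∀ ℓ' ∈ S, loc (pl ℓ') x ∈ Tv ℓ')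
    {ν : ℕ} (hν : ∃ m : Finset ι, m.card = ν ∧ c m ≠ 0) (hmin : ∀ m : Finset ι, m.card < ν → c m = 0) :
    finrank F (Sel (ε₀ ^^ Nat.bodd ν)) = ν + 1 ∧ Sel (ε₀ ^^ Nat.bodd ν) = SelRel (ε₀ ^^ Nat.bodd ν) ∧
      finrank F (SelRel (!(ε₀ ^^ Nat.bodd ν))) ≤ ν := by
  haveI := hfin (ε₀ ^^ Nat.bodd ν)
  haveI := hfin (!(ε₀ ^^ Nat.bodd ν))
  -- Sel ≤ SelRel
  have hle : Sel (ε₀ ^^ Nat.bodd ν) ≤ SelRel (ε₀ ^^ Nat.bodd ν) := fun x hx ↦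
    (hSelRel _ _).mpr ⟨((hSel _ _).mp hx).1, fun v _ ↦ ((hSel _ _).mp hx).2 v⟩
  haveI : FiniteDimensional F (Sel (ε₀ ^^ Nat.bodd ν)) := Submodule.finiteDimensional_of_le hle
  -- the configuration ℓ₁, …, ℓ_{2ν+1}
  obtain ⟨f, hf, hdiag⟩ := exists_configuration_eigen E loc b L pl Fv Tv c ε₀ hpl hLF hisoL hisoT hperf hrec hcE hcL
    hcT hfs hCheb1 hCheb2 hSupply hν
  -- ν + 1 ≤ dim Sel ε
  have h1 : ν + 1 ≤ finrank F (Sel (ε₀ ^^ Nat.bodd ν)) :=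
    succ_le_finrank_sel E loc L pl c ε₀ Sel hSel hcE hcL hfs hmin hf hdiag
  -- dim SelRel ε ≤ ν + 1: dimension count along the diagonal localisations, joint kernel trivial
  have hoffB : ∀ i ≤ ν, pl (f (ν + i)) ∉ B := fun i hi h ↦ hdiag i hi (hB _ h _)
  choose e he using hline
  have hcount := finrank_le_add_finrank_inf_iInf_ker loc (SelRel (ε₀ ^^ Nat.bodd ν)) (fun j ↦ pl (f (ν + j)))
    (fun j ↦ e (f (ν + j)) (ε₀ ^^ Nat.bodd ν)) (ν + 1) fun j hj x hx ↦
      he (f (ν + j)) _ x ((hSelRel _ _).mp hx).1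
        (by rw [← hLF]; exact ((hSelRel _ _).mp hx).2 _ (hoffB j (Nat.lt_succ_iff.mp hj)))
  have hbot : (SelRel (ε₀ ^^ Nat.bodd ν) ⊓ ⨅ (j : ℕ) (_ : j < ν + 1), LinearMap.ker (loc (pl (f (ν + j))))) = ⊥ := by
    refine (Submodule.eq_bot_iff _).mpr fun x hx ↦ ?_
    refine eq_zero_of_mem_selRel_of_loc_window_eq_zero E loc b L pl Fv Tv c ε₀ B SelRel hSelRel hB hpl hLF hisoL
      hperf hrec hcE hcL hcT hfs hCheb2 hf (hdiag ν le_rfl) (Submodule.mem_inf.mp hx).1 fun j hj ↦ ?_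
    exact LinearMap.mem_ker.mp
      ((Submodule.mem_iInf _).mp ((Submodule.mem_iInf _).mp (Submodule.mem_inf.mp hx).2 j) (Nat.lt_succ_iff.mpr hj))
  rw [hbot, finrank_bot, add_zero] at hcount
  have h3 : finrank F (Sel (ε₀ ^^ Nat.bodd ν)) ≤ finrank F (SelRel (ε₀ ^^ Nat.bodd ν)) := Submodule.finrank_mono hle
  refine ⟨by omega, Submodule.eq_of_le_of_finrank_le hle (by omega), ?_⟩
  exact finrank_selRel_not_le E loc b L pl Fv Tv c ε₀ B SelRel hSelRel hB hpl hLF hisoL hperf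
    (fun ℓ s ↦ ⟨e ℓ s, he ℓ s⟩) hrec hcE hcL hcT hfs hCheb2 hf hdiag

/-- **The (A3) shape of the METHOD engine DERIVED, (Cheb1) for eigenclasses only** — `triangulation` with the
weaker one-class Čebotarev input; conclusion VERBATIM the engine's
`∃ (s : Bool) (d : ℕ), finrank F (Sel s) = d + 1 ∧ Sel s = SelRel s ∧ finrank F (SelRel (!s)) ≤ d`.
[cite: WZhang2014, Lemma 8.4 (1)+(3)] [cite: McCallumLMS1991, Cor. 3.2, Lemma 5.3] -/
theorem triangulation_eigen [DecidableEq ι] [DecidableEq P] (E : Bool → Submodule F H)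
    (loc : (v : P) → H →ₗ[F] Hv v) (b : (v : P) → Hv v →ₗ[F] Hv v →ₗ[F] F) (L : (v : P) → Submodule F (Hv v))
    (pl : ι → P) (Fv Tv : (ℓ : ι) → Submodule F (Hv (pl ℓ))) (c : Finset ι → H) (ε₀ : Bool)
    (B : Set P) (Sel SelRel : Bool → Submodule F H)
    (hSel : ∀ (s : Bool) (x : H), x ∈ Sel s ↔ x ∈ E s ∧ ∀ v, loc v x ∈ L v)
    (hSelRel : ∀ (s : Bool) (x : H), x ∈ SelRel s ↔ x ∈ E s ∧ ∀ v, v ∉ B → loc v x ∈ L v)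
    (hfin : ∀ s, FiniteDimensional F (SelRel s))
    (hB : ∀ v ∈ B, ∀ m : Finset ι, loc v (c m) = 0)
    (hpl : Function.Injective pl)
    (hLF : ∀ ℓ, L (pl ℓ) = Fv ℓ)
    (hisoL : ∀ (v : P), ∀ x ∈ L v, ∀ y ∈ L v, b v x y = 0)
    (hisoT : ∀ (ℓ : ι), ∀ x ∈ Tv ℓ, ∀ y ∈ Tv ℓ, b (pl ℓ) x y = 0)
    (hperf : ∀ (ℓ : ι) (s : Bool), ∀ x ∈ E s, ∀ y ∈ E s, loc (pl ℓ) x ∈ Fv ℓ → loc (pl ℓ) x ≠ 0 →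
      loc (pl ℓ) y ∈ Tv ℓ → loc (pl ℓ) y ≠ 0 → b (pl ℓ) (loc (pl ℓ) x) (loc (pl ℓ) y) ≠ 0)
    (hline : ∀ (ℓ : ι) (s : Bool), ∃ e : Hv (pl ℓ), ∀ x ∈ E s, loc (pl ℓ) x ∈ Fv ℓ →
      ∃ a : F, loc (pl ℓ) x = a • e)
    (hrec : ∀ (x y : H) (T : Finset P), (∀ v, v ∉ T → b v (loc v x) (loc v y) = 0) →
      ∑ v ∈ T, b v (loc v x) (loc v y) = 0)
    (hcE : ∀ m : Finset ι, c m ∈ E (ε₀ ^^ Nat.bodd m.card))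
    (hcL : ∀ (m : Finset ι) (v : P), (∀ ℓ ∈ m, pl ℓ ≠ v) → loc v (c m) ∈ L v)
    (hcT : ∀ (m : Finset ι), ∀ ℓ ∈ m, loc (pl ℓ) (c m) ∈ Tv ℓ)
    (hfs : ∀ (m : Finset ι) (ℓ : ι), ℓ ∉ m → (loc (pl ℓ) (c (insert ℓ m)) = 0 ↔ loc (pl ℓ) (c m) = 0))
    (hCheb1 : ∀ (s : Bool), ∀ x ∈ E s, x ≠ 0 → ∀ S : Finset ι, ∃ ℓ, ℓ ∉ S ∧ loc (pl ℓ) x ≠ 0)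
    (hCheb2 : ∀ (s : Bool), ∀ x ∈ E s, ∀ y ∈ E (!s), x ≠ 0 → y ≠ 0 → ∀ S : Finset ι,
      ∃ ℓ, ℓ ∉ S ∧ loc (pl ℓ) x ≠ 0 ∧ loc (pl ℓ) y ≠ 0)
    (hSupply : ∀ (ℓ : ι) (S : Finset ι), ℓ ∉ S → ∀ s : Bool, ∃ x ∈ E s, x ≠ 0 ∧
      (∀ v : P, v ≠ pl ℓ → (∀ ℓ' ∈ S, pl ℓ' ≠ v) → loc v x ∈ L v) ∧ ∀ ℓ' ∈ S, loc (pl ℓ') x ∈ Tv ℓ')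
    (hne : ∃ m : Finset ι, c m ≠ 0) :
    ∃ (s : Bool) (d : ℕ), finrank F (Sel s) = d + 1 ∧ Sel s = SelRel s ∧ finrank F (SelRel (!s)) ≤ d := by
  classical
  -- the vanishing order
  have hex : ∃ k : ℕ, ∃ m : Finset ι, m.card = k ∧ c m ≠ 0 := by
    obtain ⟨m, hm⟩ := hne
    exact ⟨m.card, m, rfl, hm⟩
  refine ⟨ε₀ ^^ Nat.bodd (Nat.find hex), Nat.find hex, ?_⟩
  have hν : ∃ m : Finset ι, m.card = Nat.find hex ∧ c m ≠ 0 := Nat.find_spec hex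
  have hmin : ∀ m : Finset ι, m.card < Nat.find hex → c m = 0 := by
    intro m hm
    by_contra h
    exact Nat.find_min hex hm ⟨m, rfl, h⟩
  exact triangulation_at_eigen E loc b L pl Fv Tv c ε₀ B Sel SelRel hSel hSelRel hfin hB hpl hLF hisoL hisoT hperf hline
    hrec hcE hcL hcT hfs hCheb1 hCheb2 hSupply hν hmin

/-- **Zhang's induction (Thm. 9.1) on good levels with (A3) derived from Kolyvagin-system axioms, (Cheb1) for
eigenclasses only** — `exists_ne_zero_of_zhangInduction_on_of_kolyvaginSystem` with the weaker one-class Čebotarev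
input (the shape of `McCallum1991_cor_3_2_pow_of_chebotarev` with `r = 1`). CONDITIONAL on every binder; uniform in
`F`; nothing is booked. [cite: WZhang2014, Thm. 9.1, Lemma 8.4, §8.1] [cite: McCallumLMS1991, Cor. 3.2, Lemma 5.3] -/
theorem exists_ne_zero_of_zhangInduction_on_of_kolyvaginSystem_eigen [DecidableEq ι] [DecidableEq P] [DecidableEq Q]
    (Good : Finset Q → Prop)
    (Sel : Finset Q → Bool → Submodule F H) (SelRel : Finset Q → Set Q → Bool → Submodule F H)
    (B : Finset Q → Set Q) (κ : Finset ι → Finset Q → H) (m₁ : Finset ι)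
    -- Kolyvagin-system data: eigenspaces, local spaces ∕ pairings, level-n Selmer structures, places, signs
    (E : Bool → Submodule F H) (loc : (v : P) → H →ₗ[F] Hv v) (b : (v : P) → Hv v →ₗ[F] Hv v →ₗ[F] F)
    (L : Finset Q → (v : P) → Submodule F (Hv v)) (pl : ι → P) (plQ : Q → P)
    (Fv Tv : (ℓ : ι) → Submodule F (Hv (pl ℓ))) (ε₀ : Finset Q → Bool)
    -- the level-n Selmer spaces have the printed membership; relaxed spaces finite; B n ⊆ vanishing locus
    (hSel : ∀ n, Good n → ∀ (s : Bool) (x : H), x ∈ Sel n s ↔ x ∈ E s ∧ ∀ v, loc v x ∈ L n v)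
    (hSelRel : ∀ n, Good n → ∀ (s : Bool) (x : H),
      x ∈ SelRel n (B n) s ↔ x ∈ E s ∧ ∀ v, v ∉ plQ '' B n → loc v x ∈ L n v)
    (hfin : ∀ (n : Finset Q) (S : Set Q) (s : Bool), FiniteDimensional F (SelRel n S s))
    (hB : ∀ n, ∀ q ∈ B n, ∀ m, loc (plQ q) (κ m n) = 0)
    -- the local picture at Kolyvagin primes and global reciprocity
    (hpl : Function.Injective pl)
    (hLF : ∀ n ℓ, L n (pl ℓ) = Fv ℓ)
    (hisoL : ∀ n (v : P), ∀ x ∈ L n v, ∀ y ∈ L n v, b v x y = 0)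
    (hisoT : ∀ (ℓ : ι), ∀ x ∈ Tv ℓ, ∀ y ∈ Tv ℓ, b (pl ℓ) x y = 0)
    (hperf : ∀ (ℓ : ι) (s : Bool), ∀ x ∈ E s, ∀ y ∈ E s, loc (pl ℓ) x ∈ Fv ℓ → loc (pl ℓ) x ≠ 0 →
      loc (pl ℓ) y ∈ Tv ℓ → loc (pl ℓ) y ≠ 0 → b (pl ℓ) (loc (pl ℓ) x) (loc (pl ℓ) y) ≠ 0)
    (hline : ∀ (ℓ : ι) (s : Bool), ∃ e : Hv (pl ℓ), ∀ x ∈ E s, loc (pl ℓ) x ∈ Fv ℓ →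
      ∃ a : F, loc (pl ℓ) x = a • e)
    (hrec : ∀ (x y : H) (T : Finset P), (∀ v, v ∉ T → b v (loc v x) (loc v y) = 0) →
      ∑ v ∈ T, b v (loc v x) (loc v y) = 0)
    -- Kolyvagin-system axioms at each good level: signs, property (1) off ∕ on the support, (8.1) as used
    (hcE : ∀ n, Good n → ∀ m : Finset ι, κ m n ∈ E (ε₀ n ^^ Nat.bodd m.card))
    (hcL : ∀ n, Good n → ∀ (m : Finset ι) (v : P), (∀ ℓ ∈ m, pl ℓ ≠ v) → loc v (κ m n) ∈ L n v)
    (hcT : ∀ n, Good n → ∀ (m : Finset ι), ∀ ℓ ∈ m, loc (pl ℓ) (κ m n) ∈ Tv ℓ)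
    (hfs : ∀ n, Good n → ∀ (m : Finset ι) (ℓ : ι), ℓ ∉ m →
      (loc (pl ℓ) (κ (insert ℓ m) n) = 0 ↔ loc (pl ℓ) (κ m n) = 0))
    -- (Cheb) = Lemma 8.1 (one class; two classes of opposite signs), (Supply) = Lemma 8.2 for the structure L n
    (hCheb1 : ∀ (s : Bool), ∀ x ∈ E s, x ≠ 0 → ∀ S : Finset ι, ∃ ℓ, ℓ ∉ S ∧ loc (pl ℓ) x ≠ 0)
    (hCheb2 : ∀ (s : Bool), ∀ x ∈ E s, ∀ y ∈ E (!s), x ≠ 0 → y ≠ 0 → ∀ S : Finset ι,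
      ∃ ℓ, ℓ ∉ S ∧ loc (pl ℓ) x ≠ 0 ∧ loc (pl ℓ) y ≠ 0)
    (hSupply : ∀ n, Good n → ∀ (ℓ : ι) (S : Finset ι), ℓ ∉ S → ∀ s : Bool, ∃ x ∈ E s, x ≠ 0 ∧
      (∀ v : P, v ≠ pl ℓ → (∀ ℓ' ∈ S, pl ℓ' ≠ v) → loc v x ∈ L n v) ∧ ∀ ℓ' ∈ S, loc (pl ℓ') x ∈ Tv ℓ')
    -- the engine's other inputs, verbatim from `ZhangInductionOnPos`
    (hA1 : ∀ (n : Finset Q) (μ : Bool) (c : H), Good n → c ∈ Sel n μ → c ≠ 0 →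
      ∃ q, q ∉ n ∧ Good (insert q n) ∧ c ∉ Sel (insert q n) μ ∧ Sel (insert q n) μ ≤ Sel n μ ∧
        finrank F (Sel (insert q n) μ) + 1 = finrank F (Sel n μ) ∧ Sel (insert q n) (!μ) = Sel n (!μ))
    (hA2 : ∀ (n : Finset Q) (q₁ q₂ : Q), Good n → Good (insert q₁ n) → Good (insert q₂ (insert q₁ n)) →
      q₁ ∉ n → q₂ ∉ insert q₁ n → q₂ ∉ B (insert q₂ (insert q₁ n)) → ∃ m, κ m n ≠ 0)
    (hA4 : ∀ (n : Finset Q) (q : Q) (S : Set Q) (s : Bool), Good n → Good (insert q n) → q ∉ n → q ∈ S →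
      Sel n s ≤ SelRel (insert q n) S s)
    (hA5 : ∀ (n : Finset Q), Good n → Even n.card →
      finrank F (Sel n true) + finrank F (Sel n false) = 1 → κ m₁ n ≠ 0)
    (hA6 : ∀ (n : Finset Q), Good n → Even n.card → Odd (finrank F (Sel n true) + finrank F (Sel n false))) :
    ∀ (n : Finset Q), Good n → Even n.card → ∃ m, κ m n ≠ 0 := by
  refine ZhangInductionOnPos.exists_ne_zero_of_zhangInduction_on_pos Good Sel SelRel B κ m₁ hA1 hA2
    (fun n hg _ _ hne ↦ ?_) hA4 hA5 hA6
  -- (A3) at the good level n: Lemma 8.4 (1)+(3) for the system κ(·, n), base set plQ '' B n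
  have hB' : ∀ v ∈ plQ '' B n, ∀ m : Finset ι, loc v (κ m n) = 0 := by
    rintro v ⟨q, hq, rfl⟩ m
    exact hB n q hq m
  obtain ⟨s, d, h1, h2, h3⟩ := triangulation_eigen E loc b (L n) pl Fv Tv (fun m ↦ κ m n) (ε₀ n) (plQ '' B n)
    (Sel n) (SelRel n (B n)) (hSel n hg) (hSelRel n hg) (fun s ↦ hfin n (B n) s) hB' hpl (hLF n) (hisoL n)
    hisoT hperf hline hrec (hcE n hg) (hcL n hg) (hcT n hg) (hfs n hg) hCheb1 hCheb2 (hSupply n hg) hne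
  exact ⟨s, d, h1, h2, hfin n (B n) (!s), h3⟩

end Summit.BirchSwinnertonDyer.Rank1Residual.X11b.Three.Koly.ZhangTriangulation
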